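import Summits.CriticalPhenomena.PercolationContinuityZ3.Theorems.PercNearOneGluingNoHeavyLowerTailSahiCTCRtForm
import Summits.CriticalPhenomena.PercolationContinuityZ3.Theorems.PercNearOneGluingNoHeavyLowerTailSahiCTCSmallWorldNA
import HarnessLib

/-!
# `NoHeavyLowerTail` (crux stmt-CriticalPhenomena-4575), P3 lane: `R_t ∈ ℕ[s]` FOR INDEPENDENT SUPPORTS, every `t` (regime (b) of memo g27 §5)

Support file (seat `prim-l12-p3`, gen 28; `--supports stmt-CriticalPhenomena-4575`).  Composition of `…SahiCTCRtForm.coeff_Rt_nonneg_of_Nt`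
(`R_t = Θ_{t−1}·H + Π·N_t`, Harris block) with `…SahiCTCSmallWorldNA.coeff_smallWorld_nonneg_of_determined` (`N_t ∈ ℕ[s]` for up-sets determined by
disjoint coordinate sets): **`coeff_Rt_nonneg_of_determined`**.  Together with `coeff_Rt_nonneg_of_below_inter_eq_empty` (regime (a): no common small
sets) both extreme regimes of memo g27 §5 are tree theorems for every `t`; the general pair is the transfer principle of memo g28.  Nothing is asserted
about the crux.
-/

noncomputable section

open scoped Classical

namespace Summit.CriticalPhenomena.PercolationContinuityZ3.Theorems.SahiCTCForms

open Finset MvPolynomial SahiCTCGenFun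

variable {α : Type*} [DecidableEq α] [Fintype α]

/-- **`R_t(𝒳,𝒵) ∈ ℕ[s]` for every `t` whenever the up-sets `𝒳, 𝒵` are determined by complementary coordinate sets** (`S ∈ 𝒳 ↔ S ∩ I ∈ 𝒳`,
`S ∈ 𝒵 ↔ S \ I ∈ 𝒵`). [this work] -/
theorem coeff_Rt_nonneg_of_determined {𝒳 𝒵 : Finset (Finset α)} (h𝒳 : IsUpperSet (𝒳 : Set (Finset α)))
    (h𝒵 : IsUpperSet (𝒵 : Set (Finset α))) {I : Finset α} (hX : ∀ S : Finset α, S ∈ 𝒳 ↔ S ∩ I ∈ 𝒳)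
    (hZ : ∀ S : Finset α, S ∈ 𝒵 ↔ S \ I ∈ 𝒵) (t : ℕ) (n : α →₀ ℕ) : 0 ≤ (Rt t 𝒳 𝒵).coeff n :=
  coeff_Rt_nonneg_of_Nt h𝒳 h𝒵 (fun m => by
    unfold Nt below bySize
    exact coeff_smallWorld_nonneg_of_determined h𝒳 h𝒵 hX hZ t m) n

end Summit.CriticalPhenomena.PercolationContinuityZ3.Theorems.SahiCTCForms
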